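import Literature.MathematicalPhysics.QuantumFieldTheory.Balaban1983to89.B9Eq370LetterConversionL2
import Literature.MathematicalPhysics.QuantumFieldTheory.Balaban1983to89.B9Eq371Composition

/-!
# `Balaban1983to89.B9Eq38CrossLettersL2` — «we may always replace ∇_U by ∇*_U, and vice versa» (p. 398) AT THE LETTER LEVEL, IN `L²`: the two
# transport-shift letters `τ_μ`, `τ*_μ` as block-`ℓ²` letters, the identities `∇♯_{inr μ} = τ*_μ·∇♯_{inl μ}`, `∇♯_{inl μ} = ∇♯_{inr μ}·τ_μ`, and the
# CROSS CONVERSIONS of a left resp. right difference entry of any `Gp` from one orientation to the other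

T. Bałaban, *Propagators for lattice gauge theories in a background field*, Commun. Math. Phys. **99** (1985) 389–434
[`Balaban1985BackgroundPropagators`, "B9"]; [4] = T. Bałaban, *Propagators and renormalization transformations for lattice gauge
theories. II*, Commun. Math. Phys. **96** (1984) 223–250 [`Balaban1984PropagatorsII`].

statement-level skeleton of published theorems with citation tags; proofs where landed; nothing here is a claim about the
Yang–Mills mass gap

THE PRINTED LOCI.  (3.3) p. 390 (`∇_U`), (3.5) p. 391 (`U(x, x−e_μ) = U(x−e_μ, x)⁻¹`), (3.8) p. 392 (`∇*_U`); p. 398, first remark after Theorem 3.1: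
*"At first the choice of derivatives ∇_U, ∇*_U is conventional, we may always replace ∇_U by ∇*_U, and vice versa, in arbitrary place and
combination"*; (3.50) p. 400 (the transported shifts `R(U_b)λ(b₊)`); [4] Prop. 2.6 (2.140)–(2.141) p. 247, Lemma 2.1 p. 234.

WHY THIS FILE (pub-ymgap N06 row 13, seat dag-n06-c gen 9).  The INPUT half `hin` of the coded-carrier transfer for the `L²` member must produce, at a
base `U`, the AUGMENTED (3.46) readings of `B9SectBL2DictionaryY.KSC₃` (all sign combinations of the differences) from NODE 00's reading (print's six
combinations).  At the conj-`b` letter level the two orientations differ by a TRANSPORT-SHIFT LETTER on the outside: `∇♯_{inr μ} = τ*_μ·∇♯_{inl μ}` and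
`∇♯_{inl μ} = ∇♯_{inr μ}·τ_μ` (`B9Eq371Composition.covDstar_eq_neg_R_covD` and its mirror), `τ_μ`, `τ*_μ` being LOCAL letters of unit size under unitary-type
transports — hence block-`ℓ²` letters (multiplicity `1`), and the cross conversions are [4] (2.141) compositions with Lemma 2.1.
* §1 `shiftFLetter`, `shiftBLetter` (r06's `tauF`, `tauB` as `Module.End ℝ`), ★ `diffLetter_inr_eq_shiftB_mul`, ★ `diffLetter_inl_eq_mul_shiftF`,
  ★ `hasL2Majorant_shiftFLetter` ∕ `hasL2Majorant_shiftBLetter` (`≺₂ ρ²·M₂(Σ‖b_i‖)·√|ι|·e^{δd₀}·e^{−δd}`).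
* §2 ★ `hasL2Majorant_cross_left` (from `∇♯_{inl μ}·Gp ≺₂ B·w·e^{−δd}`: `∇♯_{inr μ}·Gp ≺₂ (ρ²M₂(Σ‖b_i‖)√|ι|e^{δd₀}·Λ·c₁(β))·B·w·e^{−ρd}`, transfer of `w`),
  ★ `hasL2Majorant_cross_right` (from `Gp·∇♯_{inr μ} ≺₂ B·w·e^{−δd}`: `Gp·∇♯_{inl μ} ≺₂ (…)·B·w·e^{−ρd}`, transfer of the constant weight, `Λ ≧ 1`).

HONEST SCOPE.  Finite-dimensional operator algebra over r06's concrete letters (sites `S`, COMMUTING shifts not needed here, background `U` of unitary type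
`‖U‖, ‖U⁻¹‖ ≦ ρ`); inputs and outputs are block-`ℓ²` majorants; (2.61) and the scale transfers are hypotheses.  What this does NOT give: the second
differences with mixed orientations ON THE SAME SIDE (`∇♯_{inl μ}∇♯_{inr ν}·Gp` from `∇∇Gp`): there the transport letter sits BETWEEN two differences and
its commutator with a difference is the plaquette of `U` — the located estimate of the L² member (bus, ME N06 2026-08-28).  Count-neutral bookkeeping;
NOT a node discharge; nothing continuum ∕ OS ∕ mass-gap ∕ Clay.  Cell `pub-ymgap` (HUMAN RULING D-0062), Track A node N06 [B9], row 13, 2026-08-28.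

RELATED IN THE TREE, NOT DUPLICATED: `B9Eq371Composition` (`covDstar_eq_neg_R_covD`, `norm_R_le_sq`), `B9Eq352DivForm` (`tauF`, `tauB`),
`Node00.OpsYRead342Cross` (def-Y: the same two identities pointwise on NODE 00's chart and the SUP cross entries — the sup twin of this file at the record),
`B9Ineq361L2Letters` (`hasL2Majorant_conj_of_local`), `B9Ineq363L2` (`hasL2Majorant_comp_decay`), `B9Eq370LetterConversionL2` (gen 9: the same composition
pattern for the (3.70) defect).
-/

noncomputable section

namespace Literature.MathematicalPhysics.QuantumFieldTheory.Balaban1983to89.B9Eq38CrossLettersL2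

open Literature.MathematicalPhysics.QuantumFieldTheory.Balaban1983to89
open Literature.MathematicalPhysics.QuantumFieldTheory.Balaban1983to89.B6RandomWalk (Triangle254 Ineq261)
open Literature.MathematicalPhysics.QuantumFieldTheory.Balaban1983to89.B6RandomWalkL2 (HasL2Majorant hasL2Majorant_mono)
open Literature.MathematicalPhysics.QuantumFieldTheory.Balaban1983to89.B9Thm34Ext (toB6)
open Literature.MathematicalPhysics.QuantumFieldTheory.Balaban1983to89.B9Ineq347 (ScaleTransfer)
open Literature.MathematicalPhysics.QuantumFieldTheory.Balaban1983to89.B9Eq39Adjoint (R R_smul R_inv_R covD covDstar)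
open Literature.MathematicalPhysics.QuantumFieldTheory.Balaban1983to89.B9Eq352DivForm (tauF tauB tauF_apply tauB_apply)
open Literature.MathematicalPhysics.QuantumFieldTheory.Balaban1983to89.B9Eq352DivFormLetters (conj conj_mul gradLetterF gradLetterB gradLetterF_apply
  gradLetterB_apply)
open Literature.MathematicalPhysics.QuantumFieldTheory.Balaban1983to89.B9Eq352GradLetters (diffLetter diffLetter_inl diffLetter_inr)
open Literature.MathematicalPhysics.QuantumFieldTheory.Balaban1983to89.B9Eq371Composition (covDstar_eq_neg_R_covD norm_R_le_sq)
open Literature.MathematicalPhysics.QuantumFieldTheory.Balaban1983to89.B9Ineq361L2Letters (hasL2Majorant_conj_of_local)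
open Literature.MathematicalPhysics.QuantumFieldTheory.Balaban1983to89.B9Ineq363L2 (hasL2Majorant_comp_decay hasL2Majorant_rate_mono)

/-! ## §1 The transport-shift letters, the two identities, and their block-`ℓ²` majorants -/

section Letters

variable {𝔸 : Type*} [NormedRing 𝔸] [NormedAlgebra ℂ 𝔸] [CompleteSpace 𝔸] {ι : Type} [Fintype ι] [DecidableEq ι]
variable (b : Module.Basis ι ℝ 𝔸) {S : Type} [Fintype S] [DecidableEq S] {κ : Type}
variable (T : κ → Equiv.Perm S) (U : κ → S → 𝔸ˣ)

/-- **the forward transport-shift letter `τ_μ`**: `λ ↦ (x ↦ R(U_μ(x))λ(x + e_μ))` (r06's `tauF` as an `ℝ`-linear operator).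
[cite: Balaban1985BackgroundPropagators, (3.50) p.400, (3.3) p.390] -/
def shiftFLetter (μ : κ) : Module.End ℝ (S → 𝔸) where
  toFun lam := tauF T U μ lam
  map_add' lam lam' := by funext x; simp only [tauF_apply, Pi.add_apply, B9Eq39Adjoint.R_add]
  map_smul' r lam := by funext x; simp only [tauF_apply, Pi.smul_apply, RingHom.id_apply, R_smul]

/-- **the backward transport-shift letter `τ*_μ`**: `λ ↦ (x ↦ R(U_μ(x − e_μ))⁻¹λ(x − e_μ))` (r06's `tauB`).
[cite: Balaban1985BackgroundPropagators, (3.50) p.400, (3.5) p.391, (3.8) p.392] -/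
def shiftBLetter (μ : κ) : Module.End ℝ (S → 𝔸) where
  toFun lam := tauB T U μ lam
  map_add' lam lam' := by funext x; simp only [tauB_apply, Pi.add_apply, B9Eq39Adjoint.R_add]
  map_smul' r lam := by funext x; simp only [tauB_apply, Pi.smul_apply, RingHom.id_apply, R_smul]

omit [CompleteSpace 𝔸] [Fintype ι] [DecidableEq ι] [Fintype S] [DecidableEq S] in
/-- `shiftFLetter` applied. [cite: Balaban1985BackgroundPropagators, (3.50) p.400, bookkeeping] -/
@[simp] theorem shiftFLetter_apply (μ : κ) (lam : S → 𝔸) (x : S) : shiftFLetter T U μ lam x = R (U μ x) (lam (T μ x)) := rfl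

omit [CompleteSpace 𝔸] [Fintype ι] [DecidableEq ι] [Fintype S] [DecidableEq S] in
/-- `shiftBLetter` applied. [cite: Balaban1985BackgroundPropagators, (3.50) p.400, bookkeeping] -/
@[simp] theorem shiftBLetter_apply (μ : κ) (lam : S → 𝔸) (x : S) :
    shiftBLetter T U μ lam x = R (U μ ((T μ).symm x))⁻¹ (lam ((T μ).symm x)) := rfl

omit [CompleteSpace 𝔸] [Fintype ι] [DecidableEq ι] [Fintype S] [DecidableEq S] in
/-- ★ **`∇♯_{inr μ} = τ*_μ·∇♯_{inl μ}`** — the backward difference letter is the backward transport-shift of the forward one ((3.8) with (3.5):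
`(∇*_μg)(x) = −R(U_μ(x−e_μ))⁻¹(∇_μg)(x−e_μ)`; the letter `∇♯_{inr μ}` is `−c·D*_μ`). [cite: Balaban1985BackgroundPropagators, (3.8) p.392, (3.5) p.391, p.398 (first remark)] -/
theorem diffLetter_inr_eq_shiftB_mul (c : ℂ) (μ : κ) :
    diffLetter T U c (Sum.inr μ) = shiftBLetter T U μ * diffLetter T U c (Sum.inl μ) := by
  apply LinearMap.ext; intro lam; funext x
  rw [diffLetter_inr, diffLetter_inl, LinearMap.neg_apply, Pi.neg_apply, gradLetterB_apply, Module.End.mul_apply, shiftBLetter_apply,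
    gradLetterF_apply, covDstar_eq_neg_R_covD T U μ lam x, smul_neg, neg_neg, R_smul]

omit [CompleteSpace 𝔸] [Fintype ι] [DecidableEq ι] [Fintype S] [DecidableEq S] in
/-- ★ **`∇♯_{inl μ} = ∇♯_{inr μ}·τ_μ`** — the forward difference letter is the backward one composed with the forward transport-shift (`∇_μ = −∇*_μ∘τ_μ`).
[cite: Balaban1985BackgroundPropagators, (3.3) p.390, (3.8) p.392, (3.5) p.391, p.398 (first remark)] -/
theorem diffLetter_inl_eq_mul_shiftF (c : ℂ) (μ : κ) :
    diffLetter T U c (Sum.inl μ) = diffLetter T U c (Sum.inr μ) * shiftFLetter T U μ := by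
  apply LinearMap.ext; intro lam; funext x
  rw [diffLetter_inr, diffLetter_inl, Module.End.mul_apply, LinearMap.neg_apply, Pi.neg_apply, gradLetterB_apply, gradLetterF_apply, covDstar, covD,
    shiftFLetter_apply, shiftFLetter_apply, Equiv.apply_symm_apply, R_inv_R, smul_sub, smul_sub, neg_sub]

variable {g : B9.Geometry} [Fintype g.Site] {Rr : ℝ} {H : Prop}

omit [CompleteSpace 𝔸] in
/-- a one-neighbour local letter of size `c₀` under the stencil bound `d₀` is a block-`ℓ²` letter `≺₂ c₀·M₂(Σ‖b_i‖)·√|ι|·e^{δd₀}·e^{−δd}` (multiplicity `1`: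
the neighbour map is injective). [cite: Balaban1984PropagatorsII, Prop. 2.6 (2.140) p.247, (2.51) p.232] -/
theorem hasL2Majorant_conj_of_oneNeighbour (blk : S → g.Site) (nb : S → S) (hinj : Function.Injective nb) (c₀ d₀ δ M₂ : ℝ) (hc₀ : 0 ≤ c₀) (hδ : 0 ≤ δ)
    (hM₂ : 0 ≤ M₂) (hrepr : ∀ (v : 𝔸) (i : ι), |b.repr v i| ≤ M₂ * ‖v‖) (hd₀ : ∀ x, g.dist (blk x) (blk (nb x)) ≤ d₀)
    (L : Module.End ℝ (S → 𝔸)) (hL : ∀ (f : S → 𝔸) (x : S), ‖L f x‖ ≤ c₀ * ‖f (nb x)‖) :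
    HasL2Majorant (g := toB6 g Rr H) (fun p : S × ι => blk p.1) (conj b L)
      (fun y y' => (c₀ * M₂ * (∑ i, ‖b i‖) * Real.sqrt (Fintype.card ι) * Real.exp (δ * d₀)) * Real.exp (-(δ * g.dist y y'))) := by
  let near : S → S → Prop := fun x x' => x' = nb x
  have hnear : ∀ x x', near x x' → g.dist (blk x) (blk x') ≤ d₀ := fun x x' hx' => by simp only [near] at hx'; rw [hx']; exact hd₀ x
  have hmult : ∀ x' : S, ∃ s : Finset S, (s.card : ℝ) ≤ (1 : ℕ) ∧ ∀ x, near x x' → x ∈ s := by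
    classical
    intro x'
    refine ⟨Finset.univ.filter (fun x => nb x = x'), ?_, fun x hx => ?_⟩
    · have hle : (Finset.univ.filter (fun x => nb x = x')).card ≤ 1 := by
        refine Finset.card_le_one.2 fun x hx y hy => ?_
        rw [Finset.mem_filter] at hx hy
        exact hinj (hx.2.trans hy.2.symm)
      exact_mod_cast hle
    · rw [Finset.mem_filter]
      exact ⟨Finset.mem_univ _, Eq.symm hx⟩
  refine hasL2Majorant_mono (g := toB6 g Rr H) _
    (hasL2Majorant_conj_of_local (Rr := Rr) (H := H) b blk near (fun _ => c₀) d₀ δ M₂ 1 (fun _ => hc₀) hδ hM₂ hrepr hnear hmult L ?_)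
    fun y y' => le_of_eq ?_
  · intro f x B hB
    exact (hL f x).trans (mul_le_mul_of_nonneg_left (hB _ rfl) hc₀)
  · have h1 : Real.sqrt ((1 * Fintype.card ι : ℕ) : ℝ) = Real.sqrt (Fintype.card ι) := by rw [one_mul]
    rw [h1]; ring

omit [CompleteSpace 𝔸] in
/-- ★ **`τ_μ` IS A BLOCK-`ℓ²` LETTER**: under transports `‖U‖, ‖U⁻¹‖ ≦ ρ` and the forward stencil bound `d(y(x), y(x+e_μ)) ≦ d₀`:
`conj b τ_μ ≺₂ ρ²·M₂(Σ‖b_i‖)·√|ι|·e^{δd₀}·e^{−δd}` for every `δ ≧ 0`. [cite: Balaban1985BackgroundPropagators, (3.50) p.400, (3.5) p.391; Balaban1984PropagatorsII, Prop. 2.6 (2.140) p.247] -/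
theorem hasL2Majorant_shiftFLetter (blk : S → g.Site) (ρ d₀ δ M₂ : ℝ) (hδ : 0 ≤ δ) (hM₂ : 0 ≤ M₂) (hrepr : ∀ (v : 𝔸) (i : ι), |b.repr v i| ≤ M₂ * ‖v‖)
    (hρ : ∀ μ x, ‖((U μ x : 𝔸ˣ) : 𝔸)‖ ≤ ρ ∧ ‖(((U μ x)⁻¹ : 𝔸ˣ) : 𝔸)‖ ≤ ρ) (hd₀ : ∀ μ x, g.dist (blk x) (blk (T μ x)) ≤ d₀) (μ : κ) :
    HasL2Majorant (g := toB6 g Rr H) (fun p : S × ι => blk p.1) (conj b (shiftFLetter T U μ))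
      (fun y y' => (ρ ^ 2 * M₂ * (∑ i, ‖b i‖) * Real.sqrt (Fintype.card ι) * Real.exp (δ * d₀)) * Real.exp (-(δ * g.dist y y'))) :=
  hasL2Majorant_conj_of_oneNeighbour b (Rr := Rr) (H := H) blk (T μ) (T μ).injective (ρ ^ 2) d₀ δ M₂ (sq_nonneg ρ) hδ hM₂ hrepr (hd₀ μ) _
    fun f x => by rw [shiftFLetter_apply]; exact norm_R_le_sq (U μ x) (hρ μ x).1 (hρ μ x).2 _

omit [CompleteSpace 𝔸] in
/-- ★ **`τ*_μ` IS A BLOCK-`ℓ²` LETTER** (backward stencil bound `d(y(x), y(x−e_μ)) ≦ d₀`).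
[cite: Balaban1985BackgroundPropagators, (3.50) p.400, (3.5) p.391; Balaban1984PropagatorsII, Prop. 2.6 (2.140) p.247] -/
theorem hasL2Majorant_shiftBLetter (blk : S → g.Site) (ρ d₀ δ M₂ : ℝ) (hδ : 0 ≤ δ) (hM₂ : 0 ≤ M₂) (hrepr : ∀ (v : 𝔸) (i : ι), |b.repr v i| ≤ M₂ * ‖v‖)
    (hρ : ∀ μ x, ‖((U μ x : 𝔸ˣ) : 𝔸)‖ ≤ ρ ∧ ‖(((U μ x)⁻¹ : 𝔸ˣ) : 𝔸)‖ ≤ ρ) (hd₀ : ∀ μ x, g.dist (blk x) (blk ((T μ).symm x)) ≤ d₀) (μ : κ) :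
    HasL2Majorant (g := toB6 g Rr H) (fun p : S × ι => blk p.1) (conj b (shiftBLetter T U μ))
      (fun y y' => (ρ ^ 2 * M₂ * (∑ i, ‖b i‖) * Real.sqrt (Fintype.card ι) * Real.exp (δ * d₀)) * Real.exp (-(δ * g.dist y y'))) :=
  hasL2Majorant_conj_of_oneNeighbour b (Rr := Rr) (H := H) blk (fun x => (T μ).symm x) (T μ).symm.injective (ρ ^ 2) d₀ δ M₂ (sq_nonneg ρ) hδ hM₂
    hrepr (hd₀ μ) _ fun f x => by
      rw [shiftBLetter_apply]
      have hV : ‖(((U μ ((T μ).symm x))⁻¹ : 𝔸ˣ) : 𝔸)‖ ≤ ρ ∧ ‖((((U μ ((T μ).symm x))⁻¹)⁻¹ : 𝔸ˣ) : 𝔸)‖ ≤ ρ := by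
        rw [inv_inv]; exact ⟨(hρ μ _).2, (hρ μ _).1⟩
      exact norm_R_le_sq _ hV.1 hV.2 _

end Letters

/-! ## §2 ★ The cross conversions of a left resp. right difference entry -/

section Cross

variable {𝔸 : Type*} [NormedRing 𝔸] [NormedAlgebra ℂ 𝔸] {ι : Type} [Fintype ι] [DecidableEq ι]
variable (b : Module.Basis ι ℝ 𝔸) {S : Type} [Fintype S] [DecidableEq S] {κ : Type}
variable (T : κ → Equiv.Perm S) (U : κ → S → 𝔸ˣ)
variable {g : B9.Geometry} [Fintype g.Site] {Rr : ℝ} {H : Prop}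

/-- ★ **LEFT CROSS CONVERSION `∇♯_{inl μ}·Gp ↦ ∇♯_{inr μ}·Gp`**: if `∇♯_{U,inl μ}·Gp ≺₂ B·w·e^{−δd}` (a forward left entry, any weight `w ≧ 0` with its scale
transfer at `α`, constant `Λ`), then under transports `≦ ρu`, the backward stencil bound `d₀` and (2.61) at `β`: `∇♯_{U,inr μ}·Gp ≺₂
(ρu²M₂(Σ‖b_i‖)√|ι|e^{δd₀}·Λ·c₁(β))·B·w·e^{−ρd}` for `ρ ≧ 0`, `ρ + (α+β)δ₀ ≦ δ`. [cite: Balaban1985BackgroundPropagators, p.398 (first remark), (3.8) p.392; Balaban1984PropagatorsII, Prop. 2.6 (2.140)–(2.141) p.247, Lemma 2.1 p.234] -/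
theorem hasL2Majorant_cross_left (blk : S → g.Site) (d : ℕ) (c : ℂ) (ρu d₀ M₂ δ₀ δ α β ρ Λ B : ℝ) (w : g.Site → ℝ) (hw : ∀ a, 0 ≤ w a)
    (hδ : 0 ≤ δ) (hM₂ : 0 ≤ M₂) (hB : 0 ≤ B) (hΛ : 0 ≤ Λ) (hρ : 0 ≤ ρ) (hr : ρ + (α + β) * δ₀ ≤ δ) (hρδ : ρ ≤ δ)
    (hrepr : ∀ (v : 𝔸) (i : ι), |b.repr v i| ≤ M₂ * ‖v‖)
    (hdnn : ∀ a a' : g.Site, 0 ≤ g.dist a a') (htri : Triangle254 (toB6 g Rr H))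
    (h261 : Ineq261 d (toB6 g Rr H) δ₀ β) (hT : ScaleTransfer g δ₀ α Λ w)
    (hρu : ∀ μ x, ‖((U μ x : 𝔸ˣ) : 𝔸)‖ ≤ ρu ∧ ‖(((U μ x)⁻¹ : 𝔸ˣ) : 𝔸)‖ ≤ ρu)
    (hd₀ : ∀ μ x, g.dist (blk x) (blk ((T μ).symm x)) ≤ d₀) (μ : κ) {Gp : Module.End ℝ (S × ι → ℝ)}
    (hDG : HasL2Majorant (g := toB6 g Rr H) (fun p : S × ι => blk p.1) (conj b (diffLetter T U c (Sum.inl μ)) * Gp)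
      (fun a a' => B * w a * Real.exp (-(δ * g.dist a a')))) :
    HasL2Majorant (g := toB6 g Rr H) (fun p : S × ι => blk p.1) (conj b (diffLetter T U c (Sum.inr μ)) * Gp)
      (fun a a' => ((ρu ^ 2 * M₂ * (∑ i, ‖b i‖) * Real.sqrt (Fintype.card ι) * Real.exp (δ * d₀)) * Λ * B6.c1 d δ₀ β * B) * w a *
        Real.exp (-(ρ * g.dist a a'))) := by
  set cS : ℝ := ρu ^ 2 * M₂ * (∑ i, ‖b i‖) * Real.sqrt (Fintype.card ι) * Real.exp (δ * d₀) with hcS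
  have hSb : 0 ≤ ∑ i, ‖b i‖ := Finset.sum_nonneg fun i _ => norm_nonneg _
  have hcS0 : 0 ≤ cS := by positivity
  have hshift := hasL2Majorant_shiftBLetter b T U (Rr := Rr) (H := H) blk ρu d₀ δ M₂ hδ hM₂ hrepr hρu hd₀ μ
  have hDGρ : HasL2Majorant (g := toB6 g Rr H) (fun p : S × ι => blk p.1) (conj b (diffLetter T U c (Sum.inl μ)) * Gp)
      (fun a a' => B * w a * Real.exp (-(ρ * g.dist a a'))) :=
    hasL2Majorant_rate_mono (R := Rr) (H := H) _ B w hB hw hρδ hdnn hDG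
  have hcomp := hasL2Majorant_comp_decay (R := Rr) (H := H) (fun p : S × ι => blk p.1) d δ₀ α β ρ δ Λ cS B (fun _ => (1 : ℝ)) w
    (fun _ => zero_le_one) hw hΛ hcS0 hB hρ hr hdnn htri hT h261
    (hasL2Majorant_mono (g := toB6 g Rr H) _ hshift fun a a' => le_of_eq (by ring)) hDGρ
  rw [diffLetter_inr_eq_shiftB_mul T U c μ, B9Eq352DivFormLetters.conj_mul, mul_assoc]
  exact hasL2Majorant_mono (g := toB6 g Rr H) _ hcomp fun a a' => le_of_eq (by ring)

/-- ★ **RIGHT CROSS CONVERSION `Gp·∇♯_{inr μ} ↦ Gp·∇♯_{inl μ}`**: if `Gp·∇♯_{U,inr μ} ≺₂ B·w·e^{−δd}` (a backward right entry), then under transports `≦ ρu`,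
the forward stencil bound `d₀`, `Λ ≧ 1` (the transfer of the constant weight) and (2.61) at `β`: `Gp·∇♯_{U,inl μ} ≺₂ (ρu²M₂(Σ‖b_i‖)√|ι|e^{ρd₀}·Λ·c₁(β))·B·w·e^{−ρd}`
for `ρ ≧ 0`, `ρ + (α+β)δ₀ ≦ δ`, `0 ≦ αδ₀`. [cite: Balaban1985BackgroundPropagators, p.398 (first remark), (3.3) p.390; Balaban1984PropagatorsII, Prop. 2.6 (2.140)–(2.141) p.247, Lemma 2.1 p.234] -/
theorem hasL2Majorant_cross_right (blk : S → g.Site) (d : ℕ) (c : ℂ) (ρu d₀ M₂ δ₀ δ α β ρ Λ B : ℝ) (w : g.Site → ℝ) (hw : ∀ a, 0 ≤ w a)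
    (hM₂ : 0 ≤ M₂) (hB : 0 ≤ B) (hΛ : 1 ≤ Λ) (hρ : 0 ≤ ρ) (hr : ρ + (α + β) * δ₀ ≤ δ) (hαδ : 0 ≤ α * δ₀)
    (hrepr : ∀ (v : 𝔸) (i : ι), |b.repr v i| ≤ M₂ * ‖v‖)
    (hdnn : ∀ a a' : g.Site, 0 ≤ g.dist a a') (htri : Triangle254 (toB6 g Rr H))
    (h261 : Ineq261 d (toB6 g Rr H) δ₀ β)
    (hρu : ∀ μ x, ‖((U μ x : 𝔸ˣ) : 𝔸)‖ ≤ ρu ∧ ‖(((U μ x)⁻¹ : 𝔸ˣ) : 𝔸)‖ ≤ ρu)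
    (hd₀ : ∀ μ x, g.dist (blk x) (blk (T μ x)) ≤ d₀) (μ : κ) {Gp : Module.End ℝ (S × ι → ℝ)}
    (hGD : HasL2Majorant (g := toB6 g Rr H) (fun p : S × ι => blk p.1) (Gp * conj b (diffLetter T U c (Sum.inr μ)))
      (fun a a' => B * w a * Real.exp (-(δ * g.dist a a')))) :
    HasL2Majorant (g := toB6 g Rr H) (fun p : S × ι => blk p.1) (Gp * conj b (diffLetter T U c (Sum.inl μ)))
      (fun a a' => ((ρu ^ 2 * M₂ * (∑ i, ‖b i‖) * Real.sqrt (Fintype.card ι) * Real.exp (ρ * d₀)) * Λ * B6.c1 d δ₀ β * B) * w a *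
        Real.exp (-(ρ * g.dist a a'))) := by
  set cS : ℝ := ρu ^ 2 * M₂ * (∑ i, ‖b i‖) * Real.sqrt (Fintype.card ι) * Real.exp (ρ * d₀) with hcS
  have hSb : 0 ≤ ∑ i, ‖b i‖ := Finset.sum_nonneg fun i _ => norm_nonneg _
  have hcS0 : 0 ≤ cS := by positivity
  have hΛ0 : 0 ≤ Λ := le_trans zero_le_one hΛ
  -- the transfer of the constant weight: `e^{−αδ₀d}·1 ≤ Λ·1`
  have hT1 : ScaleTransfer g δ₀ α Λ (fun _ => (1 : ℝ)) := fun y y' => by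
    rw [mul_one, mul_one]
    have : Real.exp (-(α * δ₀ * g.dist y y')) ≤ 1 := Real.exp_le_one_iff.2 (by nlinarith [hdnn y y'])
    exact this.trans hΛ
  have hshift := hasL2Majorant_shiftFLetter b T U (Rr := Rr) (H := H) blk ρu d₀ ρ M₂ hρ hM₂ hrepr hρu hd₀ μ
  have hcomp := hasL2Majorant_comp_decay (R := Rr) (H := H) (fun p : S × ι => blk p.1) d δ₀ α β ρ δ Λ B cS w (fun _ => (1 : ℝ))
    hw (fun _ => zero_le_one) hΛ0 hB hcS0 hρ hr hdnn htri hT1 h261 hGD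
    (hasL2Majorant_mono (g := toB6 g Rr H) _ hshift fun a a' => le_of_eq (by ring))
  rw [diffLetter_inl_eq_mul_shiftF T U c μ, B9Eq352DivFormLetters.conj_mul, ← mul_assoc]
  exact hasL2Majorant_mono (g := toB6 g Rr H) _ hcomp fun a a' => le_of_eq (by ring)

end Cross

end Literature.MathematicalPhysics.QuantumFieldTheory.Balaban1983to89.B9Eq38CrossLettersL2

end
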